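import Summits.BirchSwinnertonDyer.BirchSwinnertonDyer.Theorems.BiquadraticEisensteinDescentEisensteinHeartFlatCMInertBadKPrimeRangeCharacter
import Summits.BirchSwinnertonDyer.BirchSwinnertonDyer.Theorems.BiquadraticEisensteinDescentEisensteinHeartFlatCMInertBadKPrimeRangeAvatar
import Summits.BirchSwinnertonDyer.BirchSwinnertonDyer.Theorems.BiquadraticEisensteinDescentEisensteinHeartFlatCMInertBadKPrimeRangeInfinite
import HarnessLib

set_option linter.dupNamespace false -- `Summit.BirchSwinnertonDyer.BirchSwinnertonDyer.Theorems.…` (summit = sub, D-0017)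
set_option autoImplicit false

/-!
# Hsieh's range has a NON-TORSION point at EVERY ODD prime — the range witness of cruxes 21341 / 19225 as a theorem

Routes `InertBadSignedBranches` / `BiquadraticEisensteinDescent` (cell `pub/bsd-wall`, width seat `bsd-wall-cm-bed-w1` g21).
THEOREMS ONLY; supports, does not close, stmt-BirchSwinnertonDyer-19225 (`InertBadAtThree`) — and serves stmt-BirchSwinnertonDyer-21341
(`EisensteinHeartFlatCMInertBadKPrime`) identically.

Skeleton v8.2 of crux 21341 (`Cruxes/EisensteinHeartFlatCMInertBadKPrime/Lines/hsieh_lambda.lean`, lead `bsd-wall-cm-bed-p1` g11) reshaped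
the crux's one research stub along the seam every proof must cross: Hsieh's range
`R = {(χ, r) : χ everywhere unramified of type (n, −n), n ≥ 1, r a p-adic avatar of χ through the anticyclotomic κ}`
must contain a point whose node `r(γ) − 1` is NOT of finite order (so `R` is infinite; on a finite node set the divisibility
`∃ m, p^m · Ch ⊆ (G)` for EVERY `G` is false). The three kernel stubs R1/R2/R3 of that seam are tree theorems
(`…RangeCharacter.stub_rangeCharacter` p719262, `…RangeAvatar.stub_rangeAvatar` p719120, `…RangeInfinite.stub_rangeInfinite` p719685),
but their composition `hsiehRangeWitness` lives only in the skeleton (a `Cruxes/` file with a `sorry`, not importable).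

This file makes the composition a THEOREM, `exists_rangeWitness_of_ne_two`, at every ODD prime `p` (R1 and R3 have no condition on `p`,
R2 needs `p ≠ 2`): for `K` imaginary quadratic, `κ` ANY anticyclotomic `ℤ_p`-extension with topological generator `γ` and any
`ι′ : ℚ̄_p ≃ ℂ` there are `χ` everywhere unramified of type `(n, −n)`, `n > 0`, and a `p`-adic avatar `r` of `χ` through `κ` with
`avatarValueAt r γ ^ q ≠ 1` for all `q ≥ 1`. It is consumed VERBATIM by the `p = 3` twin (crux 19225, `…InertBadAtThreeOfV4Rr`) and by the
odd-prime form `V4Rr_odd` (`…InertBadAtThreeHeartOfV4RrOdd`), exactly as 21341's `V4R_of_stubs` consumes `hsiehRangeWitness` at `5 ≤ p`.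
The `Fact`-instance and `p = 3` / `5 ≤ p` variants are the forms in which the registered stub texts bind `γ` and `p`.

HONEST STATUS: kernel glue of three landed theorems; nothing about any case of BSD is asserted; 19225 / 21341 stay OPEN.
References: [Weil1956] §1–§2; [Greenberg1987] §2; [Washington1997] §13.1; [Hsieh2014Crelle] Prop. 4.9 (the range of the `K′`-line).
-/

noncomputable section

open scoped NumberField
open NumberField IsDedekindDomain Field
  Literature.NumberTheory.GaloisRepresentations Literature.NumberTheory.EllipticCurves

namespace Summit.BirchSwinnertonDyer.BirchSwinnertonDyer.Theorems.InertBadSignedBranchesInertBadAtThreeRangeWitness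

open Summit.BirchSwinnertonDyer.BirchSwinnertonDyer.Theorems.BiquadraticEisensteinDescentEisensteinHeartFlatCMInertBadKPrimeRangeCharacter
  (stub_rangeCharacter)
open Summit.BirchSwinnertonDyer.BirchSwinnertonDyer.Theorems.BiquadraticEisensteinDescentEisensteinHeartFlatCMInertBadKPrimeRangeAvatar
  (stub_rangeAvatar)
open Summit.BirchSwinnertonDyer.BirchSwinnertonDyer.Theorems.BiquadraticEisensteinDescentEisensteinHeartFlatCMInertBadKPrimeRangeInfinite
  (stub_rangeInfinite)

/-- **Hsieh's range has a non-torsion point, at every odd prime.** For `K` imaginary quadratic, `p ≠ 2`, `κ` any anticyclotomic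
`ℤ_p`-extension of `K` with topological generator `γ`, and `ι′ : ℚ̄_p ≃ ℂ`: there are an everywhere-unramified Hecke character `χ` of
infinity type `(n, −n)`, `n > 0`, and a `p`-adic avatar `r` of `χ` (`IsPAdicAvatarOf ι′ χ r`) factoring through `κ`
(`FactorsThroughZp κ r`) with `avatarValueAt r γ ^ q ≠ 1` for every `q ≥ 1`. = R3 ∘ R2 ∘ R1 (`stub_rangeInfinite` ∘ `stub_rangeAvatar` ∘
`stub_rangeCharacter`); the skeleton glue `hsiehRangeWitness` of 21341 v8.2 as a theorem.
[cite: Weil1956, §1–§2] [cite: Greenberg1987, §2] [cite: Washington1997, §13.1] -/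
theorem exists_rangeWitness_of_ne_two (K : Type) [Field K] [NumberField K] (p : ℕ) [Fact p.Prime]
    (hK : IsImaginaryQuadratic K) (hp : p ≠ 2)
    (κ : ZpExtension K p) (hκ : κ.IsAnticyclotomic) (γ : Field.absoluteGaloisGroup K) (hγ : κ.IsTopGenerator γ)
    (ι' : PadicAlgCl p ≃+* ℂ) :
    ∃ (χ : HeckeCharacter K) (n : ℕ) (r : FramedGaloisRep K (PadicAlgCl p) 1), 0 < n ∧
      (∀ v : HeightOneSpectrum (𝓞 K), χ.IsUnramifiedAt v) ∧
      χ.HasInfinityType (fun _ ↦ (n : ℤ)) (fun _ ↦ -(n : ℤ)) ∧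
      IsPAdicAvatarOf ι' χ r ∧ FactorsThroughZp κ r ∧ ∀ q : ℕ, 0 < q → avatarValueAt r γ ^ q ≠ 1 := by
  obtain ⟨Ψ, k, hk, hΨt, hΨu⟩ := stub_rangeCharacter K hK
  obtain ⟨χ, n, r, hn, hu, ht, hav, hfac⟩ := stub_rangeAvatar K p hK hp κ hκ ι' Ψ k hk hΨt hΨu
  exact ⟨χ, n, r, hn, hu, ht, hav, hfac, stub_rangeInfinite K p hK κ γ hγ ι' χ n r hn hu ht hav hfac⟩

/-- The same with the topological generator bound by a `Fact` instance — the form in which the registered stub texts of cruxes 21341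
(`stub_V4Rr`) and 19225 bind `γ`. [cite: Weil1956, §1–§2] [cite: Washington1997, §13.1] -/
theorem exists_rangeWitness_of_ne_two_of_fact (K : Type) [Field K] [NumberField K] (p : ℕ) [Fact p.Prime]
    (hK : IsImaginaryQuadratic K) (hp : p ≠ 2)
    (κ : ZpExtension K p) (hκ : κ.IsAnticyclotomic) (γ : Field.absoluteGaloisGroup K) [Fact (κ.IsTopGenerator γ)]
    (ι' : PadicAlgCl p ≃+* ℂ) :
    ∃ (χ : HeckeCharacter K) (n : ℕ) (r : FramedGaloisRep K (PadicAlgCl p) 1), 0 < n ∧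
      (∀ v : HeightOneSpectrum (𝓞 K), χ.IsUnramifiedAt v) ∧
      χ.HasInfinityType (fun _ ↦ (n : ℤ)) (fun _ ↦ -(n : ℤ)) ∧
      IsPAdicAvatarOf ι' χ r ∧ FactorsThroughZp κ r ∧ ∀ q : ℕ, 0 < q → avatarValueAt r γ ^ q ≠ 1 :=
  exists_rangeWitness_of_ne_two K p hK hp κ hκ γ Fact.out ι'

/-- **The `p = 3` instance** (crux 19225 `InertBadAtThree`): Hsieh's range of an imaginary quadratic `K` on any anticyclotomic
`ℤ_3`-line has a non-torsion point. [cite: Weil1956, §1–§2] [cite: Washington1997, §13.1] -/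
theorem exists_rangeWitness_of_eq_three (K : Type) [Field K] [NumberField K] (p : ℕ) [Fact p.Prime]
    (hK : IsImaginaryQuadratic K) (hp : p = 3)
    (κ : ZpExtension K p) (hκ : κ.IsAnticyclotomic) (γ : Field.absoluteGaloisGroup K) [Fact (κ.IsTopGenerator γ)]
    (ι' : PadicAlgCl p ≃+* ℂ) :
    ∃ (χ : HeckeCharacter K) (n : ℕ) (r : FramedGaloisRep K (PadicAlgCl p) 1), 0 < n ∧
      (∀ v : HeightOneSpectrum (𝓞 K), χ.IsUnramifiedAt v) ∧
      χ.HasInfinityType (fun _ ↦ (n : ℤ)) (fun _ ↦ -(n : ℤ)) ∧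
      IsPAdicAvatarOf ι' χ r ∧ FactorsThroughZp κ r ∧ ∀ q : ℕ, 0 < q → avatarValueAt r γ ^ q ≠ 1 :=
  exists_rangeWitness_of_ne_two K p hK (by omega) κ hκ γ Fact.out ι'

/-- **The `5 ≤ p` instance** (crux 21341 `EisensteinHeartFlatCMInertBadKPrime`; = the skeleton's `hsiehRangeWitness` as used in
`V4R_of_stubs`). [cite: Weil1956, §1–§2] [cite: Washington1997, §13.1] -/
theorem exists_rangeWitness_of_five_le (K : Type) [Field K] [NumberField K] (p : ℕ) [Fact p.Prime]
    (hK : IsImaginaryQuadratic K) (hp : 5 ≤ p)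
    (κ : ZpExtension K p) (hκ : κ.IsAnticyclotomic) (γ : Field.absoluteGaloisGroup K) [Fact (κ.IsTopGenerator γ)]
    (ι' : PadicAlgCl p ≃+* ℂ) :
    ∃ (χ : HeckeCharacter K) (n : ℕ) (r : FramedGaloisRep K (PadicAlgCl p) 1), 0 < n ∧
      (∀ v : HeightOneSpectrum (𝓞 K), χ.IsUnramifiedAt v) ∧
      χ.HasInfinityType (fun _ ↦ (n : ℤ)) (fun _ ↦ -(n : ℤ)) ∧
      IsPAdicAvatarOf ι' χ r ∧ FactorsThroughZp κ r ∧ ∀ q : ℕ, 0 < q → avatarValueAt r γ ^ q ≠ 1 :=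
  exists_rangeWitness_of_ne_two K p hK (by omega) κ hκ γ Fact.out ι'

/-! ### Hsieh's range has INFINITELY MANY NODES (appended, w1 g21) -/

section InfiniteNodes

open Summit.BirchSwinnertonDyer.Rank1Residual.X11b.Three.LambdaSupply

/-- **Hsieh's range has infinitely many nodes, at every odd prime.** For `K` imaginary quadratic, `p ≠ 2`, `κ` any anticyclotomic
`ℤ_p`-extension with topological generator `γ` and `ι′ : ℚ̄_p ≃ ℂ`, the set of NODES `avatarValueAt r γ ∈ ℂ_p` of the points `(χ, n, r)` of
Hsieh's range (`χ` everywhere unramified of type `(n, −n)`, `n > 0`, `r` a `p`-adic avatar of `χ` through `κ`) is INFINITE: the powers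
`(χ^q, qn, e ∘ ψ^q)`, `q ≥ 1`, of the witness `(χ, n, r = e ∘ ψ)` of `exists_rangeWitness_of_ne_two` are again range points
(`isUnramifiedAt_pow'`, `HasInfinityType.pow_nat`, `isPAdicAvatarOf_pow`, `factorsThroughZp_unitsChar_iff`) with nodes `u^q`
(`avatarValueAt_unitsChar_pow`), pairwise distinct because `u = ψ(γ)` is not of finite order (`injective_pow_iff_not_isOfFinOrder`). This is
the precise form of «the range is infinite» used by every proof of the cruxes: on a FINITE node set the divisibility `∃ m, p^m · Ch ⊆ (G)` for
EVERY admissible `G` is false (add `H · ∏ (T − (u_i − 1))` to `G`). [cite: Weil1956, §1–§2] [cite: Washington1997, §13.1] -/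
theorem infinite_rangeNodes_of_ne_two (K : Type) [Field K] [NumberField K] (p : ℕ) [Fact p.Prime]
    (hK : IsImaginaryQuadratic K) (hp : p ≠ 2)
    (κ : ZpExtension K p) (hκ : κ.IsAnticyclotomic) (γ : Field.absoluteGaloisGroup K) (hγ : κ.IsTopGenerator γ)
    (ι' : PadicAlgCl p ≃+* ℂ) :
    Set.Infinite {u : ℂ_[p] | ∃ (χ : HeckeCharacter K) (n : ℕ) (r : FramedGaloisRep K (PadicAlgCl p) 1), 0 < n ∧
      (∀ v : HeightOneSpectrum (𝓞 K), χ.IsUnramifiedAt v) ∧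
      χ.HasInfinityType (fun _ ↦ (n : ℤ)) (fun _ ↦ -(n : ℤ)) ∧
      IsPAdicAvatarOf ι' χ r ∧ FactorsThroughZp κ r ∧ u = avatarValueAt r γ} := by
  obtain ⟨χ, n, r, hn, hu, ht, hav, hfac, hnt⟩ := exists_rangeWitness_of_ne_two K p hK hp κ hκ γ hγ ι'
  -- the currency `r = e ∘ ψ`
  set e := (FramedRep.unitsContinuousMulEquivOfUnique (Fin 1) (PadicAlgCl p) :
    (PadicAlgCl p)ˣ →ₜ* GL (Fin 1) (PadicAlgCl p)) with he
  set ψ : absoluteGaloisGroup K →ₜ* (PadicAlgCl p)ˣ :=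
    ((FramedRep.unitsContinuousMulEquivOfUnique (Fin 1) (PadicAlgCl p)).symm :
      GL (Fin 1) (PadicAlgCl p) →ₜ* (PadicAlgCl p)ˣ).comp r with hψ
  have hr : r = e.comp ψ := by rw [hψ, he, comp_symm_comp_eq]
  rw [hr] at hav hfac hnt
  have hχu' : ∀ v : HeightOneSpectrum (𝓞 K), ((p : ℕ) : 𝓞 K) ∉ v.asIdeal → χ.IsUnramifiedAt v := fun v _ => hu v
  refine Set.infinite_of_injective_forall_mem (f := fun q : ℕ ↦ avatarValueAt (e.comp ψ) γ ^ (q + 1)) ?_ ?_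
  · -- the nodes `u^(q+1)` are pairwise distinct: `ψ γ` is not of finite order
    have hU : ¬ IsOfFinOrder (ψ γ) := by
      rw [isOfFinOrder_iff_pow_eq_one]
      rintro ⟨q, hq, hq1⟩
      apply hnt q hq
      rw [avatarValueAt_unitsChar, PadicComplex.coe_eq, ← map_pow, ← Units.val_pow_eq_pow_val, hq1, Units.val_one, map_one]
    have hinjU := (injective_pow_iff_not_isOfFinOrder (x := ψ γ)).mpr hU
    intro a b hab
    have hab' : (ψ γ) ^ (a + 1) = (ψ γ) ^ (b + 1) := by
      apply Units.ext
      apply (algebraMap (PadicAlgCl p) ℂ_[p]).injective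
      rw [Units.val_pow_eq_pow_val, Units.val_pow_eq_pow_val, map_pow, map_pow, ← PadicComplex.coe_eq,
        ← avatarValueAt_unitsChar]
      exact hab
    exact Nat.succ_injective (hinjU hab')
  · -- every `u^(q+1)` is the node of the range point `(χ^(q+1), (q+1)n, e ∘ ψ^(q+1))`
    intro q
    refine ⟨χ ^ (q + 1), (q + 1) * n, e.comp (ψ ^ (q + 1)), Nat.mul_pos q.succ_pos hn,
      fun v ↦ isUnramifiedAt_pow' (hu v) _, ?_, isPAdicAvatarOf_pow ι' hav hχu' _, ?_, ?_⟩
    · have htq := Summit.BirchSwinnertonDyer.Rank1Residual.X11b.LambdaSupply.HasInfinityType.pow_nat ht (q + 1)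
      have e1 : (fun _ : InfinitePlace K ↦ ((q + 1 : ℕ) : ℤ) * (n : ℤ)) = fun _ ↦ (((q + 1) * n : ℕ) : ℤ) := by
        funext w; push_cast; ring
      have e2 : (fun _ : InfinitePlace K ↦ ((q + 1 : ℕ) : ℤ) * -(n : ℤ)) = fun _ ↦ -(((q + 1) * n : ℕ) : ℤ) := by
        funext w; push_cast; ring
      rw [e1, e2] at htq
      exact htq
    · rw [factorsThroughZp_unitsChar_iff] at hfac ⊢
      intro σ hσ
      rw [ContinuousMonoidHom.pow_apply, hfac σ hσ, one_pow]
    · exact (Summit.BirchSwinnertonDyer.Rank1Residual.X11b.LambdaSupply.avatarValueAt_unitsChar_pow ψ γ (q + 1)).symm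

end InfiniteNodes

end Summit.BirchSwinnertonDyer.BirchSwinnertonDyer.Theorems.InertBadSignedBranchesInertBadAtThreeRangeWitness

end
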